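import Summits.KontsevichZagierPeriods.Zeta5Search.LaiSweepShard

/-!
# `κ₃` sweep certificate — shard file 059 of 127 (shards 413–419 of 889)

HONEST FRAMING. Systematic search; no irrationality claim unless certified. This file only checks,
by `decide +kernel`, shards 413–419 of the order-cell sweep of the `κ₃` point `(74, 2180, 444; δ74)`
(engine `LaiSweepEngine`, soundness `LaiSweepJump/Free/Eval/Shard/Kappa3`; a shard is `⟨regime, n,
p, q, p', q', Lo, Up⟩`: `n` cells from `p/q` to `p'/q'` with integer rate sums in `[Lo, Up]`, `K =
128`, `D = 2^40`). It draws NO conclusion: only the capstone `LaiKappa3SweepCert`, which needs all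
127 shard files, does. Kernel cost of this file ≈ 560 cells × 0.3 s.
-/

namespace Summit.KontsevichZagierPeriods.Zeta5Search.Sweep

set_option maxHeartbeats 100000000 in
/-- Shard 413: 80 cells of regime B from `155/386` to `143/355`.
[cite: Lai2024BallRivoal, §4 Lemma 4.3] -/
theorem shard413 :
    Shard.check 128 (2^40)
      ⟨true, 80, 155, 386, 143, 355, 17813642421386, 20251254419691⟩ = true := by
  decide +kernel

set_option maxHeartbeats 100000000 in
/-- Shard 414: 80 cells of regime B from `143/355` to `139/344`.
[cite: Lai2024BallRivoal, §4 Lemma 4.3] -/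
theorem shard414 :
    Shard.check 128 (2^40)
      ⟨true, 80, 143, 355, 139, 344, 17646650499869, 20077907370763⟩ = true := by
  decide +kernel

set_option maxHeartbeats 100000000 in
/-- Shard 415: 80 cells of regime B from `139/344` to `107/264`.
[cite: Lai2024BallRivoal, §4 Lemma 4.3] -/
theorem shard415 :
    Shard.check 128 (2^40)
      ⟨true, 80, 139, 344, 107, 264, 17317607058476, 19719585103889⟩ = true := by
  decide +kernel

set_option maxHeartbeats 100000000 in
/-- Shard 416: 80 cells of regime B from `107/264` to `161/396`.
[cite: Lai2024BallRivoal, §4 Lemma 4.3] -/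
theorem shard416 :
    Shard.check 128 (2^40)
      ⟨true, 80, 107, 264, 161, 396, 17695422693211, 20166496447472⟩ = true := by
  decide +kernel

set_option maxHeartbeats 100000000 in
/-- Shard 417: 80 cells of regime B from `161/396` to `177/434`.
[cite: Lai2024BallRivoal, §4 Lemma 4.3] -/
theorem shard417 :
    Shard.check 128 (2^40)
      ⟨true, 80, 161, 396, 177, 434, 17735314572705, 20228591386503⟩ = true := by
  decide +kernel

set_option maxHeartbeats 100000000 in
/-- Shard 418: 80 cells of regime B from `177/434` to `1965/4804`.
[cite: Lai2024BallRivoal, §4 Lemma 4.3] -/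
theorem shard418 :
    Shard.check 128 (2^40)
      ⟨true, 80, 177, 434, 1965, 4804, 16733277072735, 19101054410543⟩ = true := by
  decide +kernel

set_option maxHeartbeats 100000000 in
/-- Shard 419: 80 cells of regime B from `1965/4804` to `103/251`.
[cite: Lai2024BallRivoal, §4 Lemma 4.3] -/
theorem shard419 :
    Shard.check 128 (2^40)
      ⟨true, 80, 1965, 4804, 103, 251, 18417949566141, 21041922825176⟩ = true := by
  decide +kernel

/-- The checked shards of this file, in order. [folklore] -/
def shards059 : List (CheckedShard 128 (2^40)) :=
  [⟨_, shard413⟩, ⟨_, shard414⟩, ⟨_, shard415⟩, ⟨_, shard416⟩, ⟨_, shard417⟩,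
    ⟨_, shard418⟩, ⟨_, shard419⟩]

end Summit.KontsevichZagierPeriods.Zeta5Search.Sweep
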